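import Summits.CriticalPhenomena.Ising3DConformalLimit.Theses.ReflectionTwin
import HarnessLib

/-!
# Scratch: the REDUCED open goal of stub `stub_replicaMirrorUpper` (S5), k = 2 cross instance
(one OLD point `x` strictly below the plane, one NEW point `y` strictly above). Not proposed.
-/

noncomputable section

namespace Summit.CriticalPhenomena.Ising3DConformalLimit.Cruxes.TwinTransparency.ReplicaMirror

open scoped BigOperators Topology Manifold Classical MeasureTheory ProbabilityTheory Matrix InnerProductSpace ComplexConjugate ContinuousMap
open Filter Set Function TopologicalSpace MeasureTheory
open Literature.Probability.LatticeModels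

/-- REDUCED OPEN GOAL `replicaMirrorCross₂` (response mirror symmetry, two-point cross instance): for `x` below and
`y` above the plane, `ρ(δ)² · limsup_L ⟨σ_{[x/δ]} · E_L[σ'_{[θy/δ]} | spins off {h ≤ -1}]⟩^∅_{box L; β_c(3)} → S₂(x, y)`.
[folklore] -/
theorem replicaMirrorCross_two_OPEN :
    ∀ (ρ : ℝ → ℝ) (S : CorrFamily 3), (∀ δ ∈ Set.Ioc (0:ℝ) 1, 0 < ρ δ) → HasPointwiseScalingLimit (criticalCorr 3) ρ S → IsNondegenerateTwoPoint S → ∀ (x y : EuclideanSpace ℝ (Fin 3)), x 0 + x 1 + x 2 < 0 → 0 < y 0 + y 1 + y 2 → Filter.Tendsto (fun δ : ℝ => ρ δ ^ 2 * Filter.limsup (fun L : ℕ => PairIsing.gibbsAvg (fun a b : ↥(box 3 L) => if (∑ i, |a.1 i - b.1 i| = 1) then criticalBeta 3 / 2 else (0:ℝ)) (fun s => (if h : latticeApprox δ x ∈ box 3 L then spinAt (⟨latticeApprox δ x, h⟩ : ↥(box 3 L)) s else 0) * ((∑ s' ∈ Finset.univ.filter (fun s' : SpinConfig ↥(box 3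 L) => ∀ a : ↥(box 3 L), ¬ (a.1 0 + a.1 1 + a.1 2 ≤ -1) → s' a = s a), (if h : latticeApprox δ (((ℝ ∙ (EuclideanSpace.single 0 1 + EuclideanSpace.single 1 1 + EuclideanSpace.single 2 1 : EuclideanSpace ℝ (Fin 3)))ᗮ).reflection y) ∈ box 3 L then spinAt (⟨latticeApprox δ (((ℝ ∙ (EuclideanSpace.single 0 1 + EuclideanSpace.single 1 1 + EuclideanSpace.single 2 1 : EuclideanSpace ℝ (Fin 3)))ᗮ).reflection y), h⟩ : ↥(box 3 L)) s' else 0) * PairIsing.gibbsWeight (fun a b : ↥(box 3 L) => if (∑ i, |a.1 i - b.1 i| = 1) then criticalBeta 3 / 2 else (0:ℝ)) s') / (∑ s' ∈ Finset.univ.filter (fun s' : SpinConfig ↥(box 3 L) => ∀ a : ↥(box 3 L), ¬ (a.1 0 + a.1 1 + a.1 2 ≤ -1) → s' a = s a), PairIsing.gibbsWeight (fun a b : ↥(box 3 L) => if (∑ i, |a.1 i - b.1 i| = 1) then criticalBeta 3 / 2 else (0:ℝ)) s')))) Filter.atTop) (𝓝[>] (0:ℝ)) (𝓝 (S 2 ![x,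 y])) := by
  sorry

end Summit.CriticalPhenomena.Ising3DConformalLimit.Cruxes.TwinTransparency.ReplicaMirror

end
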